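import Literature.NumberTheory.LFunctions.FeketePolyaKernelReweightedFactors
import Literature.NumberTheory.LFunctions.FeketePolyaKernelCertificatesResidueWrappers
import HarnessLib

/-!
# Reweighted Fekete–Pólya block certificates: the engine and the per-conductor wrappers

Topic `Literature/NumberTheory/LFunctions`; namespace `Literature.NumberTheory.LFunctions.FeketePolyaKernel`
(sequel of `FeketePolyaKernelCertificatesWeighted.lean` and `FeketePolyaReweighted.lean`). THEOREMS only (no named fact, no `sorry`). A FACTOR LIST `fs = [(p₁, ε₁), …]` (`p_i ≥ 2`,
`ε_i = ±1`) stands for the positive Euler-type factor `G(s) = ∏ (1 + ε_i p_i^{−s})`; `twOf fs` is its expansion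
`[(d, c_d)]` over the sub-products, and the reweighted value stream of a primitive quadratic `χ` (values `v`) is
`x(n) = Σ c_d·[d ∣ n]·v(n/d)` — the coefficients of `L(s, χ)·G(s)`. Examples: `ε = −χ(p)` removes the multiples of
`p` (the induced character `χ↑(pq)`), `ε = +χ(p)` doubles them, `ε = ±1` at `p ∣ q` adds `±v(n/p)` on the
multiples of `p`. If the block certificate `blockCertD b e K N |twOf fs| (rwTabs kind b ps N (twOf fs))` passes
(iterated sums of order `K` non-negative over the period `N`, a common multiple of the `d·q`), then `L(σ, χ) ≠ 0` on
`(0, 1)`: `lfunction_ne_zero_of_rwCert` (through `FeketePolyaReweighted.lfunction_ne_zero_of_reweighted`) and the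
wrappers `good_{odd,even}_of_{odd,four,eight}_rw` (statement shape of the range-file bullets). Cell
`parity-realchar`, kernel floor of the wide column, Fekete–Pólya lane (seat prover-2): these certificates exist for
≈ 8 % of the fundamental discriminants that have no plain Fekete–Pólya witness.

## References

* H. L. Montgomery, R. C. Vaughan, *Multiplicative Number Theory I*, CUP 2007, §9.3 Thm 9.13, §11.2.1
  Exercises 7–8. [MontgomeryVaughan2007]
* J. B. Rosser, *Real roots of real Dirichlet L-series*, J. Res. NBS 45 (1950) 505–514. [Rosser1950RealRoots]
-/

namespace Literature.NumberTheory.LFunctions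

namespace FeketePolyaKernel

open Finset Literature.Analysis.Convolution FeketePolyaTable FeketePolyaReweighted
  Literature.Barriers.RiemannHypothesis PrimitiveQuadratic SmallModuli OddSmallModuliII
open scoped NumberTheorySymbols

/-! ### The engine for reweighted streams -/

/-- **The engine for reweighted streams.** `χ ≠ χ₀` quadratic mod `q` with `ℜχ = v`, a factor list `fs`
(`p ≥ 2`, `ε = ±1`), a period `N ≥ 1` with `d·q ∣ N` for all `(d, c) ∈ twOf fs`, `K ≥ 1`, `b ≥ 2` with
`|twOf fs| < 2^b`, and a passing `blockCertD` on the weight tables `(kpack (rwDp v tw), kpack (rwDm v tw))`: then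
`L(σ, χ) ≠ 0` for all `σ > 0`. [cite: MontgomeryVaughan2007, §11.2.1 Exercises 7 (g), 8] -/
theorem lfunction_ne_zero_of_rwCert {q : ℕ} [NeZero q] (χ : DirichletCharacter ℂ q) (hχ : χ ≠ 1)
    (hquad : χ.IsQuadratic) (v : ℕ → ℤ) (hv : ∀ n : ℕ, (χ (n : ZMod q)).re = v n)
    (fs : List (ℕ × ℤ)) (hfs : ∀ pe ∈ fs, 2 ≤ pe.1 ∧ (pe.2 = 1 ∨ pe.2 = -1)) {N K b e : ℕ} (hN : 1 ≤ N)
    (hqN : ∀ dc ∈ twOf fs, dc.1 * q ∣ N) (hK : 1 ≤ K) (hb : 2 ≤ b) (hD : (twOf fs).length < 2 ^ b)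
    (h : blockCertD b e K N (twOf fs).length
      (kpack b N (rwDp v (twOf fs)), kpack b N (rwDm v (twOf fs))) = true)
    {σ : ℝ} (hσ : 0 < σ) : χ.LFunction (σ : ℂ) ≠ 0 := by
  set tw := twOf fs with htw
  have htwp := twOf_props fs hfs
  -- the value function `v`
  have hv0 : v 0 = 0 := by exact_mod_cast (hv 0).symm.trans (re_apply_natCast_zero χ hχ)
  have hvper : ∀ n, v (n + q) = v n := fun n => by
    have := hv (n + q)
    rw [Nat.cast_add, ZMod.natCast_self, add_zero, hv n] at this
    exact_mod_cast this.symm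
  have hv3 : ∀ n, Val3 (v n) := fun n ↦ by
    rcases hquad (n : ZMod q) with h0 | h1 | h2
    · left; exact_mod_cast (by rw [← hv, h0, Complex.zero_re] : (v n : ℝ) = 0)
    · right; left; exact_mod_cast (by rw [← hv, h1, Complex.one_re] : (v n : ℝ) = 1)
    · right; right
      exact_mod_cast (by rw [← hv, h2, Complex.neg_re, Complex.one_re] : (v n : ℝ) = -1)
  -- the integer stream and the certificate
  set x : ℕ → ℤ := rwValZ v tw with hx
  have hxper : ∀ n, x (n + N) = x n := rwValZ_add_period hvper tw fun dc hdc => ⟨(htwp dc hdc).1, hqN dc hdc⟩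
  have hx0 : x 0 = 0 := by
    simp only [hx, rwValZ]
    rw [List.sum_eq_zero]
    intro y hy
    rw [List.mem_map] at hy
    obtain ⟨dc, -, rfl⟩ := hy
    simp [hv0]
  have hxN : x N = 0 := by rw [← zero_add N, hxper, hx0]
  obtain ⟨hle, _⟩ := And.intro (rwDp_le v tw) trivial
  obtain ⟨hA, hB⟩ := blockCertD_sound hb hD hK hN hx0 hxN (fun n => (rwDp_le v tw n).1)
    (fun n => (rwDp_le v tw n).2) (rwDp_sub_rwDm hv3 tw fun dc hdc => (htwp dc hdc).2) rfl h
  -- one period suffices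
  set l : List ℤ := (List.range N).map x with hl
  have hlen : l.length = N := by simp [hl]
  have htab : ∀ n, tableVal l n = x n := fun n => by
    rw [tableVal, hlen, hl, List.getD_eq_getElem?_getD, List.getElem?_map,
      List.getElem?_range (Nat.mod_lt n (by omega))]
    exact periodic_mod' hxper n
  have hips : ∀ k n, itS x k n = ipsum l k n := itS_eq_ipsum htab
  have hnonneg : ∀ M, 1 ≤ M → 0 ≤ ipsum l K M :=
    ipsum_nonneg_of_period l (by omega) (fun j hj hjK => by rw [hlen, ← hips]; exact hB j hj hjK)
      fun M _ hMN => by rw [← hips]; exact hA M (by omega)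
  -- the real stream is `rwSeq χ tw`
  have hfun : (fun n : ℕ ↦ ((tableVal l n : ℤ) : ℝ)) = rwSeq χ tw := by
    funext n; rw [htab, hx, cast_rwValZ χ hv]
  have hk : ∀ M, 1 ≤ M → 0 ≤ iterSummatory (rwSeq χ tw) K M := fun M hM => by
    rw [← hfun, ← ipsum_cast_real]
    exact_mod_cast hnonneg M hM
  have h1 : 0 < rwSeq χ tw 1 := by
    rw [htw, rwSeq_twOf_one χ fs hfs, Nat.cast_one, map_one, Complex.one_re]; exact one_pos
  exact lfunction_ne_zero_of_reweighted χ hχ tw (fun dc hdc => (htwp dc hdc).1) hσ (rwG_twOf_pos hσ fs hfs)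
    (abs_rwSeq_le χ tw fun dc hdc => (htwp dc hdc).2) h1
    (abs_summatory_rwSeq_le χ hχ tw htwp) hk

/-! ### Per-conductor wrappers (parity test or reweighted certificate) -/

/-- A product of odd numbers is odd. [folklore] -/
private theorem prod_mod_two'' : ∀ (ps : List ℕ), (∀ p ∈ ps, p % 2 = 1) → ps.prod % 2 = 1
  | [], _ => rfl
  | p :: rest, h => by
    rw [List.prod_cons, Nat.mul_mod, h p (by simp), prod_mod_two'' rest fun p' hp' ↦ h p' (by simp [hp'])]

/-- All entries of the factor list are odd primes. [folklore] -/
private theorem odd_of_forall' {ps : List ℕ} (hps : ps.Forall fun p ↦ p.Prime ∧ p ≠ 2) :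
    (∀ p ∈ ps, p % 2 = 1) ∧ (∀ p ∈ ps, 1 ≤ p) := by
  rw [List.forall_iff_forall_mem] at hps
  exact ⟨fun p hp ↦ (hps p hp).1.eq_two_or_odd.resolve_left (hps p hp).2, fun p hp => (hps p hp).1.one_lt.le⟩

/-- Primitive characters of modulus `≥ 2` are non-trivial. [folklore] -/
private theorem ne_one''' {q : ℕ} [NeZero q] {χ : DirichletCharacter ℂ q} (hprim : χ.IsPrimitive)
    (hq : 2 ≤ q) : χ ≠ 1 :=
  SiegelZeroQuality.ne_one_of_isPrimitive hprim hq

/-- The generic wrapper: from the side conditions, the value identification `ℜχ = plainVal kind (resTable ps)`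
for every primitive quadratic `χ` of the given parity, and a passing certificate, to `L(σ, χ) ≠ 0`.
[cite: MontgomeryVaughan2007, §11.2.1 Exercises 7 (g), 8] -/
theorem good_of_rwCert {q : ℕ} [NeZero q] (hq : 2 ≤ q) (kind : ℕ) (ps : List ℕ) (hps1 : ∀ p ∈ ps, 1 ≤ p)
    (fs : List (ℕ × ℤ)) {N K b e : ℕ} (hfs : ∀ pe ∈ fs, 2 ≤ pe.1 ∧ (pe.2 = 1 ∨ pe.2 = -1))
    (htw : ∀ dc ∈ twOf fs, dc.1 ∣ N ∧ (∀ p ∈ ps, p ∣ N / dc.1) ∧ kindPeriod kind ∣ N / dc.1 ∧ dc.1 * q ∣ N)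
    (hN : 1 ≤ N) (hK : 1 ≤ K) (hb : 2 ≤ b) (hD : (twOf fs).length < 2 ^ b)
    (h : blockCertD b e K N (twOf fs).length (rwTabs kind b ps N (twOf fs)) = true)
    (χ : DirichletCharacter ℂ q) (hquad : χ.IsQuadratic) (hprim : χ.IsPrimitive)
    (hv : ∀ n : ℕ, (χ (n : ZMod q)).re = plainVal kind (resTable ps) n) :
    ∀ σ : ℝ, 0 < σ → σ < 1 → χ.LFunction σ ≠ 0 := by
  intro σ hσ _
  have htwp := twOf_props fs hfs
  rw [rwTabs_eq (kind := kind) hb ps hps1 (twOf fs) (fun dc hdc => ⟨(htwp dc hdc).1, (htw dc hdc).1,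
    (htw dc hdc).2.1, (htw dc hdc).2.2.1⟩)] at h
  exact lfunction_ne_zero_of_rwCert χ (ne_one''' hprim hq) hquad _ hv fs hfs hN (fun dc hdc => (htw dc hdc).2.2.2)
    hK hb hD h hσ

/-- **Odd characters, odd conductor `q = ∏ ps`**: parity test or reweighted certificate (kind `0`).
[cite: MontgomeryVaughan2007, §11.2.1 Exercises 7 (g), 8] -/
theorem good_odd_of_odd_rw {q : ℕ} [NeZero q] (ps : List ℕ) (hps : ps.Forall fun p ↦ p.Prime ∧ p ≠ 2)
    (hprod : ps.prod = q) (hq1 : 1 < q) (fs : List (ℕ × ℤ)) (N K b e : ℕ) (hfs : ∀ pe ∈ fs, 2 ≤ pe.1 ∧ (pe.2 = 1 ∨ pe.2 = -1))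
    (htw : ∀ dc ∈ twOf fs, dc.1 ∣ N ∧ (∀ p ∈ ps, p ∣ N / dc.1) ∧ kindPeriod 0 ∣ N / dc.1 ∧ dc.1 * q ∣ N)
    (hN : 1 ≤ N) (hK : 1 ≤ K) (hb : 2 ≤ b) (hD : (twOf fs).length < 2 ^ b)
    (h : valOddR (resTable ps) (q - 1) = 1 ∨ blockCertD b e K N (twOf fs).length (rwTabs 0 b ps N (twOf fs)) = true) :
    ∀ χ : DirichletCharacter ℂ q, χ.IsQuadratic → χ.IsPrimitive → χ.Odd →
      ∀ σ : ℝ, 0 < σ → σ < 1 → χ.LFunction σ ≠ 0 := by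
  obtain ⟨hodd, hps1⟩ := odd_of_forall' hps
  have hq2 : q % 2 = 1 := hprod ▸ prod_mod_two'' ps hodd
  intro χ hquad hprim hpar
  have hv : ∀ n : ℕ, (χ (n : ZMod q)).re = valOddR (resTable ps) n := fun n ↦ by
    rw [valOddR_eq hps hprod hq1, re_apply_eq_valOdd (Nat.odd_iff.mpr hq2) hq1 hprim hquad]
  rcases h with hp | hrun
  · exact fun σ _ _ => (not_odd_of_val _ hv hp hpar).elim
  · exact good_of_rwCert (by omega) 0 ps hps1 fs hfs htw hN hK hb hD hrun χ hquad hprim hv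

/-- **Even characters, odd conductor**: parity test or reweighted certificate (kind `0`). [cite: MontgomeryVaughan2007, §11.2.1 Exercises 7 (g), 8] -/
theorem good_even_of_odd_rw {q : ℕ} [NeZero q] (ps : List ℕ) (hps : ps.Forall fun p ↦ p.Prime ∧ p ≠ 2)
    (hprod : ps.prod = q) (hq1 : 1 < q) (fs : List (ℕ × ℤ)) (N K b e : ℕ) (hfs : ∀ pe ∈ fs, 2 ≤ pe.1 ∧ (pe.2 = 1 ∨ pe.2 = -1))
    (htw : ∀ dc ∈ twOf fs, dc.1 ∣ N ∧ (∀ p ∈ ps, p ∣ N / dc.1) ∧ kindPeriod 0 ∣ N / dc.1 ∧ dc.1 * q ∣ N)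
    (hN : 1 ≤ N) (hK : 1 ≤ K) (hb : 2 ≤ b) (hD : (twOf fs).length < 2 ^ b)
    (h : valOddR (resTable ps) (q - 1) = -1 ∨ blockCertD b e K N (twOf fs).length (rwTabs 0 b ps N (twOf fs)) = true) :
    ∀ χ : DirichletCharacter ℂ q, χ.IsQuadratic → χ.IsPrimitive → χ.Even →
      ∀ σ : ℝ, 0 < σ → σ < 1 → χ.LFunction σ ≠ 0 := by
  obtain ⟨hodd, hps1⟩ := odd_of_forall' hps
  have hq2 : q % 2 = 1 := hprod ▸ prod_mod_two'' ps hodd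
  intro χ hquad hprim hpar
  have hv : ∀ n : ℕ, (χ (n : ZMod q)).re = valOddR (resTable ps) n := fun n ↦ by
    rw [valOddR_eq hps hprod hq1, re_apply_eq_valOdd (Nat.odd_iff.mpr hq2) hq1 hprim hquad]
  rcases h with hp | hrun
  · exact fun σ _ _ => (not_even_of_val _ hv hp hpar).elim
  · exact good_of_rwCert (by omega) 0 ps hps1 fs hfs htw hN hK hb hD hrun χ hquad hprim hv

/-- **Odd characters, conductor `4m`, `m = ∏ ps`**: parity test or reweighted certificate (kind `1`).
[cite: MontgomeryVaughan2007, §11.2.1 Exercises 7 (g), 8] -/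
theorem good_odd_of_four_rw {q : ℕ} [NeZero q] (ps : List ℕ) (hps : ps.Forall fun p ↦ p.Prime ∧ p ≠ 2)
    (hprod : 4 * ps.prod = q) (hq1 : 4 < q) (fs : List (ℕ × ℤ)) (N K b e : ℕ) (hfs : ∀ pe ∈ fs, 2 ≤ pe.1 ∧ (pe.2 = 1 ∨ pe.2 = -1))
    (htw : ∀ dc ∈ twOf fs, dc.1 ∣ N ∧ (∀ p ∈ ps, p ∣ N / dc.1) ∧ kindPeriod 1 ∣ N / dc.1 ∧ dc.1 * q ∣ N)
    (hN : 1 ≤ N) (hK : 1 ≤ K) (hb : 2 ≤ b) (hD : (twOf fs).length < 2 ^ b)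
    (h : valFourR (resTable ps) (q - 1) = 1 ∨ blockCertD b e K N (twOf fs).length (rwTabs 1 b ps N (twOf fs)) = true) :
    ∀ χ : DirichletCharacter ℂ q, χ.IsQuadratic → χ.IsPrimitive → χ.Odd →
      ∀ σ : ℝ, 0 < σ → σ < 1 → χ.LFunction σ ≠ 0 := by
  obtain ⟨hodd, hps1⟩ := odd_of_forall' hps
  subst hprod
  set m := ps.prod with hm
  haveI : NeZero m := ⟨by omega⟩
  have hm2 : m % 2 = 1 := prod_mod_two'' ps hodd
  intro χ hquad hprim hpar
  have hv : ∀ n : ℕ, (χ (n : ZMod (2 ^ 2 * m))).re = valFourR (resTable ps) n := fun n ↦ by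
    rw [valFourR_eq hps hm.symm (by omega), re_apply_eq_valFour (m := m) (Nat.odd_iff.mpr hm2) (by omega)
      hprim hquad]
  rcases h with hp | hrun
  · exact fun σ _ _ => (not_odd_of_val _ hv hp hpar).elim
  · exact good_of_rwCert (by omega) 1 ps hps1 fs hfs htw hN hK hb hD hrun χ hquad hprim hv

/-- **Even characters, conductor `4m`**: parity test or reweighted certificate (kind `1`). [cite: MontgomeryVaughan2007, §11.2.1 Exercises 7 (g), 8] -/
theorem good_even_of_four_rw {q : ℕ} [NeZero q] (ps : List ℕ) (hps : ps.Forall fun p ↦ p.Prime ∧ p ≠ 2)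
    (hprod : 4 * ps.prod = q) (hq1 : 4 < q) (fs : List (ℕ × ℤ)) (N K b e : ℕ) (hfs : ∀ pe ∈ fs, 2 ≤ pe.1 ∧ (pe.2 = 1 ∨ pe.2 = -1))
    (htw : ∀ dc ∈ twOf fs, dc.1 ∣ N ∧ (∀ p ∈ ps, p ∣ N / dc.1) ∧ kindPeriod 1 ∣ N / dc.1 ∧ dc.1 * q ∣ N)
    (hN : 1 ≤ N) (hK : 1 ≤ K) (hb : 2 ≤ b) (hD : (twOf fs).length < 2 ^ b)
    (h : valFourR (resTable ps) (q - 1) = -1 ∨ blockCertD b e K N (twOf fs).length (rwTabs 1 b ps N (twOf fs)) = true) :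
    ∀ χ : DirichletCharacter ℂ q, χ.IsQuadratic → χ.IsPrimitive → χ.Even →
      ∀ σ : ℝ, 0 < σ → σ < 1 → χ.LFunction σ ≠ 0 := by
  obtain ⟨hodd, hps1⟩ := odd_of_forall' hps
  subst hprod
  set m := ps.prod with hm
  haveI : NeZero m := ⟨by omega⟩
  have hm2 : m % 2 = 1 := prod_mod_two'' ps hodd
  intro χ hquad hprim hpar
  have hv : ∀ n : ℕ, (χ (n : ZMod (2 ^ 2 * m))).re = valFourR (resTable ps) n := fun n ↦ by
    rw [valFourR_eq hps hm.symm (by omega), re_apply_eq_valFour (m := m) (Nat.odd_iff.mpr hm2) (by omega)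
      hprim hquad]
  rcases h with hp | hrun
  · exact fun σ _ _ => (not_even_of_val _ hv hp hpar).elim
  · exact good_of_rwCert (by omega) 1 ps hps1 fs hfs htw hN hK hb hD hrun χ hquad hprim hv

/-- **Odd characters, conductor `8m`** (two value patterns; kinds `2`, `3`): for each pattern, parity test or
reweighted certificate. [cite: MontgomeryVaughan2007, §11.2.1 Exercises 7 (g), 8] -/
theorem good_odd_of_eight_rw {q : ℕ} [NeZero q] (ps : List ℕ) (hps : ps.Forall fun p ↦ p.Prime ∧ p ≠ 2)
    (hprod : 8 * ps.prod = q) (hq1 : 8 < q) (fs : List (ℕ × ℤ)) (N K b e : ℕ) (hfs : ∀ pe ∈ fs, 2 ≤ pe.1 ∧ (pe.2 = 1 ∨ pe.2 = -1))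
    (htw : ∀ dc ∈ twOf fs, dc.1 ∣ N ∧ (∀ p ∈ ps, p ∣ N / dc.1) ∧ kindPeriod 2 ∣ N / dc.1 ∧ dc.1 * q ∣ N)
    (hN : 1 ≤ N) (hK : 1 ≤ K) (hb : 2 ≤ b) (hD : (twOf fs).length < 2 ^ b)
    (hA : valEightAR (resTable ps) (q - 1) = 1 ∨ blockCertD b e K N (twOf fs).length (rwTabs 2 b ps N (twOf fs)) = true)
    (hB : valEightBR (resTable ps) (q - 1) = 1 ∨ blockCertD b e K N (twOf fs).length (rwTabs 3 b ps N (twOf fs)) = true) :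
    ∀ χ : DirichletCharacter ℂ q, χ.IsQuadratic → χ.IsPrimitive → χ.Odd →
      ∀ σ : ℝ, 0 < σ → σ < 1 → χ.LFunction σ ≠ 0 := by
  obtain ⟨hodd, hps1⟩ := odd_of_forall' hps
  subst hprod
  set m := ps.prod with hm
  haveI : NeZero m := ⟨by omega⟩
  have hm2 : m % 2 = 1 := prod_mod_two'' ps hodd
  intro χ hquad hprim hpar
  rcases re_apply_eq_valEight (m := m) (Nat.odd_iff.mpr hm2) (by omega) hprim hquad with hv | hv
  · replace hv : ∀ n : ℕ, (χ (n : ZMod (2 ^ 3 * m))).re = valEightAR (resTable ps) n := fun n ↦ by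
      rw [valEightAR_eq hps hm.symm (by omega), hv]
    rcases hA with hp | hrun
    · exact fun σ _ _ => (not_odd_of_val _ hv hp hpar).elim
    · exact good_of_rwCert (by omega) 2 ps hps1 fs hfs htw hN hK hb hD hrun χ hquad hprim hv
  · replace hv : ∀ n : ℕ, (χ (n : ZMod (2 ^ 3 * m))).re = valEightBR (resTable ps) n := fun n ↦ by
      rw [valEightBR_eq hps hm.symm (by omega), hv]
    rcases hB with hp | hrun
    · exact fun σ _ _ => (not_odd_of_val _ hv hp hpar).elim
    · exact good_of_rwCert (by omega) 3 ps hps1 fs hfs htw hN hK hb hD hrun χ hquad hprim hv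

/-- **Even characters, conductor `8m`**: for each pattern, parity test or reweighted certificate.
[cite: MontgomeryVaughan2007, §11.2.1 Exercises 7 (g), 8] -/
theorem good_even_of_eight_rw {q : ℕ} [NeZero q] (ps : List ℕ) (hps : ps.Forall fun p ↦ p.Prime ∧ p ≠ 2)
    (hprod : 8 * ps.prod = q) (hq1 : 8 < q) (fs : List (ℕ × ℤ)) (N K b e : ℕ) (hfs : ∀ pe ∈ fs, 2 ≤ pe.1 ∧ (pe.2 = 1 ∨ pe.2 = -1))
    (htw : ∀ dc ∈ twOf fs, dc.1 ∣ N ∧ (∀ p ∈ ps, p ∣ N / dc.1) ∧ kindPeriod 2 ∣ N / dc.1 ∧ dc.1 * q ∣ N)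
    (hN : 1 ≤ N) (hK : 1 ≤ K) (hb : 2 ≤ b) (hD : (twOf fs).length < 2 ^ b)
    (hA : valEightAR (resTable ps) (q - 1) = -1 ∨ blockCertD b e K N (twOf fs).length (rwTabs 2 b ps N (twOf fs)) = true)
    (hB : valEightBR (resTable ps) (q - 1) = -1 ∨ blockCertD b e K N (twOf fs).length (rwTabs 3 b ps N (twOf fs)) = true) :
    ∀ χ : DirichletCharacter ℂ q, χ.IsQuadratic → χ.IsPrimitive → χ.Even →
      ∀ σ : ℝ, 0 < σ → σ < 1 → χ.LFunction σ ≠ 0 := by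
  obtain ⟨hodd, hps1⟩ := odd_of_forall' hps
  subst hprod
  set m := ps.prod with hm
  haveI : NeZero m := ⟨by omega⟩
  have hm2 : m % 2 = 1 := prod_mod_two'' ps hodd
  intro χ hquad hprim hpar
  rcases re_apply_eq_valEight (m := m) (Nat.odd_iff.mpr hm2) (by omega) hprim hquad with hv | hv
  · replace hv : ∀ n : ℕ, (χ (n : ZMod (2 ^ 3 * m))).re = valEightAR (resTable ps) n := fun n ↦ by
      rw [valEightAR_eq hps hm.symm (by omega), hv]
    rcases hA with hp | hrun
    · exact fun σ _ _ => (not_even_of_val _ hv hp hpar).elim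
    · exact good_of_rwCert (by omega) 2 ps hps1 fs hfs htw hN hK hb hD hrun χ hquad hprim hv
  · replace hv : ∀ n : ℕ, (χ (n : ZMod (2 ^ 3 * m))).re = valEightBR (resTable ps) n := fun n ↦ by
      rw [valEightBR_eq hps hm.symm (by omega), hv]
    rcases hB with hp | hrun
    · exact fun σ _ _ => (not_even_of_val _ hv hp hpar).elim
    · exact good_of_rwCert (by omega) 3 ps hps1 fs hfs htw hN hK hb hD hrun χ hquad hprim hv

end FeketePolyaKernel

end Literature.NumberTheory.LFunctions
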